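import Summits.Parity.GeneralizedHardyLittlewood.Theorems.GreenTaoLevelTwoMNTwoLocalQuadratic

/-!
# Route `GreenTaoLevelTwo`, crux `MNTwo` (stmt-Parity-21276), line `birth`, stub `stub_mnVertical`:
# the polarization identity for `φ''` (GT 2008b §11, proof of Lemma 27)

Tool for block V5 of the `stub_mnVertical` census (B. Green, T. Tao, *Quadratic uniformity of the
Möbius function*, Ann. Inst. Fourier 58 (2008) = arXiv:math/0606087, §11, proof of Lemma 27 "Major
arcs have small second derivative, II": "For any `l ∈ {1,…,L}`, we use (bilinear) and the hypotheses
`h, h' ∈ B_g(0,ρ₂)` to conclude `4l φ''(h,h') = φ''(h+lh', h+lh') − φ''(h−lh', h−lh')`").  In the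
abstract-gauge vocabulary of `…MNTwoLocalQuadratic` (`φ''(a,b) = φ(n₀+a+b) − φ(n₀+a) − φ(n₀+b) + φ(n₀)`,
`φ` locally quadratic on the gauge ball `B(n₀,R)`), with a SYMMETRIC gauge.  Def-free.

* `second_deriv_zero_left`, `second_deriv_neg_left`, `second_deriv_zsmul_left` — `φ''(0,b) = 0`,
  `φ''(−a,b) = −φ''(a,b)`, `φ''(la,b) = l•φ''(a,b)` (`l ∈ ℤ`);
* `second_deriv_add_add` — `φ''(h+k,h+k) = φ''(h,h) + 2φ''(h,k) + φ''(k,k)`;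
* `polarization` — `φ''(h+lh',h+lh') − φ''(h−lh',h−lh') = (4l)•φ''(h,h')`.

References: [GreenTao2008QuadraticMobius] arXiv:math/0606087 §11, proof of Lemma 27; §9 (bilinear).
-/

namespace Summit.Parity.GeneralizedHardyLittlewood.GreenTaoLevelTwoMNTwoPolarization

open Summit.Parity.GeneralizedHardyLittlewood.GreenTaoLevelTwoMNTwoLocalQuadratic
  (gauge_nsmul_le second_deriv_add_left second_deriv_comm second_deriv_nsmul_left)

variable {G : Type*} [AddCommGroup G]

/-- `φ''(0, b) = 0`. [folklore] -/
theorem second_deriv_zero_left (φ : ℤ → G) (n₀ b : ℤ) :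
    φ (n₀ + 0 + b) - φ (n₀ + 0) - φ (n₀ + b) + φ n₀ = 0 := by
  rw [add_zero]; abel

/-- Multiples under a symmetric gauge: `ν(l a) ≤ |l| ν(a)` for `l ∈ ℤ`. [folklore] -/
theorem gauge_zsmul_le (ν : ℤ → ℝ) (hν0 : ν 0 = 0) (hνneg : ∀ x, ν (-x) = ν x)
    (hνadd : ∀ x y, ν (x + y) ≤ ν x + ν y) (a : ℤ) (l : ℤ) : ν (l * a) ≤ |(l : ℝ)| * ν a := by
  rcases le_or_gt 0 l with hl | hl
  · have h := gauge_nsmul_le ν hν0 hνadd a l.toNat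
    rw [show ((l.toNat : ℕ) : ℤ) = l from Int.toNat_of_nonneg hl] at h
    have e : ((l.toNat : ℕ) : ℝ) = |(l : ℝ)| := by
      rw [abs_of_nonneg (by exact_mod_cast hl)]; exact_mod_cast Int.toNat_of_nonneg hl
    rwa [e] at h
  · have h := gauge_nsmul_le ν hν0 hνadd a (-l).toNat
    have hl' : 0 ≤ -l := by omega
    rw [show (((-l).toNat : ℕ) : ℤ) = -l from Int.toNat_of_nonneg hl'] at h
    have e : (((-l).toNat : ℕ) : ℝ) = |(l : ℝ)| := by
      rw [abs_of_neg (by exact_mod_cast hl)]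
      have : (((-l).toNat : ℕ) : ℤ) = -l := Int.toNat_of_nonneg hl'
      exact_mod_cast this
    rw [e, show -l * a = -(l * a) by ring, hνneg] at h
    exact h

variable (ν : ℤ → ℝ) (hν0 : ν 0 = 0) (hνnn : ∀ x, 0 ≤ ν x) (hνneg : ∀ x, ν (-x) = ν x)
  (hνadd : ∀ x y, ν (x + y) ≤ ν x + ν y) (φ : ℤ → G) {n₀ : ℤ} {R : ℝ}
  (hφ : ∀ n a b c : ℤ, ν (n - n₀) < R → ν (n + a - n₀) < R → ν (n + b - n₀) < R →
    ν (n + c - n₀) < R → ν (n + a + b - n₀) < R → ν (n + a + c - n₀) < R →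
    ν (n + b + c - n₀) < R → ν (n + a + b + c - n₀) < R →
    φ (n + a + b + c) - φ (n + a + b) - φ (n + a + c) - φ (n + b + c)
      + φ (n + a) + φ (n + b) + φ (n + c) - φ n = 0)
include hν0 hνnn hνneg hνadd hφ

/-- **`φ''(−a, b) = −φ''(a, b)`** (`ν a, ν b < r`, `3r ≤ R`, symmetric gauge).
[cite: GreenTao2008QuadraticMobius, §9 eq. (bilinear)] -/
theorem second_deriv_neg_left {a b : ℤ} {r : ℝ} (ha : ν a < r) (hb : ν b < r) (hR : 3 * r ≤ R) :
    φ (n₀ + (-a) + b) - φ (n₀ + (-a)) - φ (n₀ + b) + φ n₀ =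
      -(φ (n₀ + a + b) - φ (n₀ + a) - φ (n₀ + b) + φ n₀) := by
  have ha' : ν (-a) < r := by rw [hνneg]; exact ha
  have h := second_deriv_add_left ν hν0 hνnn hνadd φ hφ ha ha' hb hR
  rw [add_neg_cancel, second_deriv_zero_left] at h
  exact eq_neg_of_add_eq_zero_right h.symm

/-- **`φ''(la, b) = l • φ''(a, b)` for `l ∈ ℤ`** (`|l| ν a < r`, `ν a, ν b < r`, `3r ≤ R`, symmetric
gauge). [cite: GreenTao2008QuadraticMobius, §9 eq. (bilinear)] -/
theorem second_deriv_zsmul_left {a b : ℤ} {r : ℝ} (l : ℤ) (hla : |(l : ℝ)| * ν a < r)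
    (ha : ν a < r) (hb : ν b < r) (hR : 3 * r ≤ R) :
    φ (n₀ + l * a + b) - φ (n₀ + l * a) - φ (n₀ + b) + φ n₀ =
      l • (φ (n₀ + a + b) - φ (n₀ + a) - φ (n₀ + b) + φ n₀) := by
  rcases le_or_gt 0 l with hl | hl
  · have e : ((l.toNat : ℕ) : ℤ) = l := Int.toNat_of_nonneg hl
    have hj : ((l.toNat : ℕ) : ℝ) * ν a < r := by
      have e2 : ((l.toNat : ℕ) : ℝ) = |(l : ℝ)| := by
        rw [abs_of_nonneg (by exact_mod_cast hl)]; exact_mod_cast e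
      rw [e2]; exact hla
    have h := second_deriv_nsmul_left ν hν0 hνnn hνadd φ hφ l.toNat hj ha hb hR
    rw [e] at h
    rw [h, ← natCast_zsmul, e]
  · have hl' : 0 ≤ -l := by omega
    have e : (((-l).toNat : ℕ) : ℤ) = -l := Int.toNat_of_nonneg hl'
    have hj : (((-l).toNat : ℕ) : ℝ) * ν a < r := by
      have e2 : (((-l).toNat : ℕ) : ℝ) = |(l : ℝ)| := by
        rw [abs_of_neg (by exact_mod_cast hl)]; exact_mod_cast e
      rw [e2]; exact hla
    -- `φ''((-l)·a, b) = (-l) • φ''(a,b)` and `φ''(l a, b) = -φ''((-l) a, b)`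
    have h := second_deriv_nsmul_left ν hν0 hνnn hνadd φ hφ (-l).toNat hj ha hb hR
    rw [e] at h
    have hla' : ν (-l * a) < r := by
      refine lt_of_le_of_lt (gauge_zsmul_le ν hν0 hνneg hνadd a (-l)) ?_
      push_cast; rw [abs_neg]; exact hla
    have hneg := second_deriv_neg_left ν hν0 hνnn hνneg hνadd φ hφ hla' hb hR
    rw [show -(-l * a) = l * a by ring] at hneg
    rw [hneg, h, ← natCast_zsmul, e, neg_zsmul, neg_neg]

omit hνneg in
/-- **`φ''(h+k, h+k) = φ''(h,h) + 2•φ''(h,k) + φ''(k,k)`** (`ν h, ν k < r`, `6r ≤ R`).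
[cite: GreenTao2008QuadraticMobius, §9 eq. (bilinear)] -/
theorem second_deriv_add_add {h k : ℤ} {r : ℝ} (hh : ν h < r) (hk : ν k < r) (hR : 6 * r ≤ R) :
    φ (n₀ + (h + k) + (h + k)) - φ (n₀ + (h + k)) - φ (n₀ + (h + k)) + φ n₀ =
      (φ (n₀ + h + h) - φ (n₀ + h) - φ (n₀ + h) + φ n₀) +
        2 • (φ (n₀ + h + k) - φ (n₀ + h) - φ (n₀ + k) + φ n₀) +
        (φ (n₀ + k + k) - φ (n₀ + k) - φ (n₀ + k) + φ n₀) := by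
  have hr0 : 0 ≤ ν h := hνnn _
  -- work at radius `2r`
  have hh2 : ν h < 2 * r := by linarith
  have hk2 : ν k < 2 * r := by linarith [hνnn k]
  have hhk2 : ν (h + k) < 2 * r := by linarith [hνadd h k]
  have hR2 : 3 * (2 * r) ≤ R := by linarith
  -- `φ''(h+k, h+k) = φ''(h, h+k) + φ''(k, h+k)`
  have s1 := second_deriv_add_left ν hν0 hνnn hνadd φ hφ hh2 hk2 hhk2 hR2
  -- `φ''(h, h+k) = φ''(h+k, h) = φ''(h,h) + φ''(k,h)`
  have s2 := second_deriv_add_left ν hν0 hνnn hνadd φ hφ hh2 hk2 hh2 hR2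
  -- `φ''(k, h+k) = φ''(h+k, k) = φ''(h,k) + φ''(k,k)`
  have s3 := second_deriv_add_left ν hν0 hνnn hνadd φ hφ hh2 hk2 hk2 hR2
  have c1 := second_deriv_comm φ n₀ h (h + k)
  have c2 := second_deriv_comm φ n₀ k (h + k)
  have c3 := second_deriv_comm φ n₀ k h
  rw [s1, c1, c2, s2, s3, c3, two_nsmul]
  abel

/-- **Polarization (GT 2008b §11, proof of Lemma 27):**
`φ''(h+lh', h+lh') − φ''(h−lh', h−lh') = (4l)•φ''(h,h')` for `l ∈ ℤ`, provided `ν h < r`,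
`ν h' < r`, `|l| ν h' < r` and `6r ≤ R` (symmetric gauge).
[cite: GreenTao2008QuadraticMobius, §11, proof of Lemma 27] -/
theorem polarization {h h' : ℤ} {r : ℝ} (l : ℤ) (hh : ν h < r) (hh' : ν h' < r)
    (hlh' : |(l : ℝ)| * ν h' < r) (hR : 6 * r ≤ R) :
    (φ (n₀ + (h + l * h') + (h + l * h')) - φ (n₀ + (h + l * h')) - φ (n₀ + (h + l * h')) + φ n₀) -
      (φ (n₀ + (h + -(l * h')) + (h + -(l * h'))) - φ (n₀ + (h + -(l * h'))) -
        φ (n₀ + (h + -(l * h'))) + φ n₀) =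
      (4 * l) • (φ (n₀ + h + h') - φ (n₀ + h) - φ (n₀ + h') + φ n₀) := by
  have hk : ν (l * h') < r := lt_of_le_of_lt (gauge_zsmul_le ν hν0 hνneg hνadd h' l) hlh'
  have hk' : ν (-(l * h')) < r := by rw [hνneg]; exact hk
  have hR3 : 3 * r ≤ R := by linarith [(hνnn h).trans hh.le]
  have e1 := second_deriv_add_add ν hν0 hνnn hνadd φ hφ hh hk hR
  have e2 := second_deriv_add_add ν hν0 hνnn hνadd φ hφ hh hk' hR
  -- `φ''(h, -k) = -φ''(h, k)` and `φ''(-k,-k) = φ''(k,k)`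
  have n1 : φ (n₀ + h + -(l * h')) - φ (n₀ + h) - φ (n₀ + -(l * h')) + φ n₀ =
      -(φ (n₀ + h + l * h') - φ (n₀ + h) - φ (n₀ + l * h') + φ n₀) := by
    rw [second_deriv_comm φ n₀ h (-(l * h')), second_deriv_comm φ n₀ h (l * h')]
    exact second_deriv_neg_left ν hν0 hνnn hνneg hνadd φ hφ hk hh hR3
  have n2 : φ (n₀ + -(l * h') + -(l * h')) - φ (n₀ + -(l * h')) - φ (n₀ + -(l * h')) + φ n₀ =
      φ (n₀ + l * h' + l * h') - φ (n₀ + l * h') - φ (n₀ + l * h') + φ n₀ := by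
    have a1 := second_deriv_neg_left ν hν0 hνnn hνneg hνadd φ hφ hk hk' hR3
    -- `φ''(-k, -k) = -φ''(k, -k) = -φ''(-k, k) = φ''(k, k)`
    rw [a1, second_deriv_comm φ n₀ (l * h') (-(l * h')),
      second_deriv_neg_left ν hν0 hνnn hνneg hνadd φ hφ hk hk hR3, neg_neg]
  -- `φ''(h, l h') = l • φ''(h, h')`
  have z1 : φ (n₀ + h + l * h') - φ (n₀ + h) - φ (n₀ + l * h') + φ n₀ =
      l • (φ (n₀ + h + h') - φ (n₀ + h) - φ (n₀ + h') + φ n₀) := by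
    rw [second_deriv_comm φ n₀ h (l * h'), second_deriv_comm φ n₀ h h']
    exact second_deriv_zsmul_left ν hν0 hνnn hνneg hνadd φ hφ l hlh' hh' hh hR3
  rw [e1, e2, n1, n2, z1, mul_zsmul, show (4 : ℤ) • l • _ = _ from rfl]
  simp only [smul_neg, two_nsmul]
  -- `4 • (l • D) = (l•D + l•D) + (l•D + l•D)`
  have : (4 : ℤ) • (l • (φ (n₀ + h + h') - φ (n₀ + h) - φ (n₀ + h') + φ n₀)) =
      (l • (φ (n₀ + h + h') - φ (n₀ + h) - φ (n₀ + h') + φ n₀) +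
        l • (φ (n₀ + h + h') - φ (n₀ + h) - φ (n₀ + h') + φ n₀)) +
      (l • (φ (n₀ + h + h') - φ (n₀ + h) - φ (n₀ + h') + φ n₀) +
        l • (φ (n₀ + h + h') - φ (n₀ + h) - φ (n₀ + h') + φ n₀)) := by
    rw [show (4 : ℤ) = 2 + 2 by norm_num, add_zsmul, two_zsmul]
  rw [this]
  abel

end Summit.Parity.GeneralizedHardyLittlewood.GreenTaoLevelTwoMNTwoPolarization
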